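import Literature.NumberTheory.EllipticCurves.Rank1Residual.Predicates
import Literature.NumberTheory.EllipticCurves.ComplexMultiplicationBurungaleFlachCorOneProofs
import Literature.NumberTheory.EllipticCurves.BurungaleCastellaSkinnerTian2022.CMPConverse
import Literature.NumberTheory.QuadraticFields.RingClassNumberFormula
import HarnessLib

/-!
# The CM-field predicates `CMRamified` / `CMSplit` / `CMInert` of a CM curve ARE the decomposition
# of `p` in the CM field (proofs only)

Topic `NumberTheory/EllipticCurves`, namespace `Literature.NumberTheory.EllipticCurves.Rank1Residual`
(continuing `Rank1Residual/Predicates.lean`).  THEOREMS ONLY: no definition, no named fact, no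
instance (D-0026 net named-fact debt `0`).

## What is bridged

The residual-class vocabulary of the BSD rank-`≤ 1` programme (`Predicates.lean`, the `X12` corner and
the three CM rungs K7r / K7t / K8 of `Summits/BirchSwinnertonDyer/…`) decides the behaviour of a
prime `p` in the CM field of a CM curve `W/ℚ` ARITHMETICALLY, from the table `d = cmFieldDiscrOfJ W.j`
of the CM-field discriminant (Silverman, *Advanced Topics*, App. A §3):

* `CMRamified W p`  `:= (p : ℤ) ∣ d`,
* `CMSplit W p`     `:= ¬ (p : ℤ) ∣ d ∧ (p = 2 → d ≡ 1 (mod 8)) ∧ (p ≠ 2 → d is a square mod p)`,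
* `CMInert W p`     `:= ¬ CMRamified W p ∧ ¬ CMSplit W p`.

The `K`-side Literature facts about CM curves, on the other hand, are stated over "the CM field"
`K : Type`, `[K : ℚ] = 2` with `√d ∈ K` (the frame `W.j ∈ maximalCMJInvariants`, `IsCMFieldOfJ K W.j`
of `ComplexMultiplicationBurungaleFlachDescent.lean`, used by `AgboolaHoward2005/…`, `LiXu2026/…`,
`ComplexMultiplicationDeuringConductor.lean`, `CoatesLiTianZhai2015/…`, `Kobayashi2003/…`), and say
"inert" IDEAL-THEORETICALLY: `(Ideal.span {(p : 𝓞 K)}).IsPrime` (Agboola–Howard's `hinert`,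
Li–Xu's Theorem 1), "split" as `¬ (p : ℤ) ∣ cmFieldDiscr W.j ∧ ¬ (Ideal.span {(p : 𝓞 K)}).IsPrime`
(Li–Xu) or `((Ideal.span {(p : ℤ)}).primesOver (𝓞 K)).ncard = 2` (the Heegner hypothesis files), and
"the place `𝔭 = p𝒪_K`" as `(w : HeightOneSpectrum (𝓞 K)) (hw : w.asIdeal = Ideal.span {(p : 𝓞 K)})`
(`conductorExponent_baseChange_eq_of_inert`, `hasConductorExponentAt_iff_of_inert_of_gross`).

This file proves that the two vocabularies agree — Cox, *Primes of the form x² + ny²*, §5.B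
Prop. 5.16 / Cor. 5.17 read on the nine class-number-one fields — for EVERY prime `p` (including
`p = 2`, where the arithmetic side is Cox's Kronecker symbol `(d_K/2)`) and every one of the thirteen
CM `j`-invariants (the four non-maximal orders have the field of the corresponding maximal one):

* `cmRamified_or_cmSplit_or_cmInert`, `CMSplit.not_cmRamified`, `CMInert.not_cmRamified`,
  `CMInert.not_cmSplit`, `cmSplit_iff_not_cmRamified_and_not_cmInert` — the trichotomy (logic);
* `discr_eq_cmFieldDiscrOfJ` — `NumberField.discr K = cmFieldDiscrOfJ W.j`;
* `cmRamified_iff_natCast_dvd_discr`, `cmRamified_iff_not_isUnramifiedIn` — Cor. 5.17 (i);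
* `cmSplit_iff_ncard_primesOver_eq_two` — Cor. 5.17 (ii);
* `cmInert_iff_isPrime_span` — Prop. 5.16 (iii) with its converse;
* `cmSplit_iff_not_dvd_discr_and_not_isPrime_span` — Li–Xu's spelling of "split";
* `exists_asIdeal_eq_span_of_cmInert`, `asIdeal_eq_span_of_cmInert_of_mem` — the inert place
  `𝔭 = p𝒪_K` as a `HeightOneSpectrum` and its uniqueness among the primes containing `p`;
* the same statements in the consumers' frame `(hj : W.j ∈ maximalCMJInvariants)`
  `(hK : IsCMFieldOfJ K W.j)` (`IsCMFieldOfJ.cmInert_iff_isPrime_span`, …).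

## Proof

Nothing new is computed here: the tree already PROVES the decomposition law of a quadratic field in
terms of `d_K = NumberField.discr K` —
`Literature.NumberTheory.QuadraticFields.Quadratic.ncard_primesOver_eq_two_iff_legendreSym` /
`ncard_primesOver_two_eq_two_iff` (`KroneckerSplitting.lean`, Dedekind–Kummer on `𝓞 K = ℤ[ω]`),
`Literature.NumberTheory.QuadraticFields.RingClass.isPrime_span_natCast_iff_jacobiSym_eq_neg_one` /
`isPrime_span_two_iff` / `natCast_dvd_discr_iff_not_isUnramifiedIn` (`RingClassNumberFormula.lean`) —
and the discriminant of the nine fields,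
`Literature.NumberTheory.EllipticCurves.Quadratic.discr_eq_of_sq_eq_intCast`
(`ComplexMultiplicationBurungaleFlachCorOneProofs.lean`: `[K : ℚ] = 2`, `θ² = d`,
`d ∈ {-3, -4, -7, -8, -11, -19, -43, -67, -163}` `⟹ d_K = d`).  We identify `d_K` with the table
value and translate Legendre symbols into the `IsSquare ((d : ℤ) : ZMod p)` / `d % 8` clauses of the
predicates (Mathlib `legendreSym.eq_one_iff`, `legendreSym.eq_neg_one_iff`, `legendreSym.eq_zero_iff`).

## References

* D. A. Cox, *Primes of the form x² + ny²*, 2nd ed., Wiley (2013), §5.B Prop. 5.16 and Cor. 5.17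
  (PDF pp. 119–120), with the Kronecker symbol `(D/2)` defined just before Prop. 5.16. [Cox2013]
* D. A. Marcus, *Number Fields*, 2nd ed. (2018), Ch. 3 Thm. 25. [Marcus2018]
* J. H. Silverman, *Advanced Topics in the Arithmetic of Elliptic Curves*, GTM 151 (1994), App. A §3
  (the thirteen CM `j`-invariants over `ℚ` and their fields). [SilvermanATAEC1994]

## Tree search

`rg "CMInert W p ↔|↔ CMInert|CMSplit W p ↔|CMRamified W p ↔"`: only the Summits-side cell bits
`Rank1ResidualPartitionBinding.cellOf_pK_*`; the `DeuringOrdinaryReduction*Proofs` /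
`DeuringSupersingularReduction*Proofs` files work with explicit models and never pass to `K`;
`BurungaleCastellaSkinnerTian2022.cmFieldDiscrOfJ_eq_of_cmSplit_two` / `_three` are the `p = 2, 3`
table look-ups.  No predicate ↔ ideal dictionary existed.
-/

open scoped Classical

open WeierstrassCurve NumberField IsDedekindDomain Module

namespace Literature.NumberTheory.EllipticCurves.Rank1Residual

/-! ### §0 The table `cmFieldDiscrOfJ` on the thirteen CM `j`-invariants -/

/-- On the thirteen CM `j`-invariants the CM-field discriminant `cmFieldDiscrOfJ j` is one of the nine
negative fundamental discriminants of class number one, `-3, -4, -7, -8, -11, -19, -43, -67, -163`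
(the four non-maximal orders `j = 54000, -12288000, 287496, 16581375` have fields `ℚ(√-3)`, `ℚ(√-3)`,
`ℚ(i)`, `ℚ(√-7)`). [cite: SilvermanATAEC1994, App. A §3 (table of CM j-invariants)] -/
theorem cmFieldDiscrOfJ_mem_of_mem_cmJInvariants {j : ℚ} (hj : j ∈ cmJInvariants) :
    cmFieldDiscrOfJ j ∈ ({-3, -4, -7, -8, -11, -19, -43, -67, -163} : Finset ℤ) := by
  simp only [cmJInvariants, Finset.mem_insert, Finset.mem_singleton] at hj
  rcases hj with rfl | rfl | rfl | rfl | rfl | rfl | rfl | rfl | rfl | rfl | rfl | rfl | rfl <;>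
    norm_num [cmFieldDiscrOfJ]

/-- On the thirteen CM `j`-invariants `cmFieldDiscrOfJ j ≠ 0` (the junk value `0` is taken exactly off
the table). [cite: SilvermanATAEC1994, App. A §3 (table of CM j-invariants)] -/
theorem cmFieldDiscrOfJ_ne_zero_of_mem_cmJInvariants {j : ℚ} (hj : j ∈ cmJInvariants) :
    cmFieldDiscrOfJ j ≠ 0 := by
  have h := cmFieldDiscrOfJ_mem_of_mem_cmJInvariants hj
  intro h0
  rw [h0] at h
  revert h
  decide

/-- The two tables of the tree agree on the nine maximal-order values: for
`j ∈ maximalCMJInvariants`, `cmFieldDiscrOfJ j = cmFieldDiscr j` (the latter is the table of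
`ComplexMultiplicationBurungaleFlachDescent.lean`, junk `0` off the NINE values).
[cite: SilvermanATAEC1994, App. A §3 (table of CM j-invariants)] -/
theorem cmFieldDiscrOfJ_eq_cmFieldDiscr {j : ℚ} (hj : j ∈ maximalCMJInvariants) :
    cmFieldDiscrOfJ j = cmFieldDiscr j := by
  simp only [maximalCMJInvariants, Finset.mem_insert, Finset.mem_singleton] at hj
  rcases hj with rfl | rfl | rfl | rfl | rfl | rfl | rfl | rfl | rfl <;>
    norm_num [cmFieldDiscrOfJ, cmFieldDiscr]

/-! ### §1 Trichotomy (pure logic on the three definitions) -/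

section Logic

variable (W : WeierstrassCurve ℚ) [W.IsElliptic] (p : ℕ)

/-- **Ramified, split, inert exhaust the primes** (by definition `CMInert` is "neither ramified nor
split"; Cox: "the primes in (i)–(iii) above give all nonzero primes of `𝒪_K`").
[cite: Cox2013, §5.B Prop. 5.16 (PDF p. 119)] -/
theorem cmRamified_or_cmSplit_or_cmInert : CMRamified W p ∨ CMSplit W p ∨ CMInert W p := by
  unfold CMInert
  tauto

variable {W p}

/-- A split prime is not ramified (the first clause of `CMSplit` is `¬ p ∣ d`; cases (i)/(ii) of Cox's
Prop. 5.16 are exclusive). [cite: Cox2013, §5.B Prop. 5.16 (PDF p. 119)] -/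
theorem CMSplit.not_cmRamified (h : CMSplit W p) : ¬ CMRamified W p := h.1

/-- An inert prime is not ramified (cases (i)/(iii) of Cox's Prop. 5.16 are exclusive).
[cite: Cox2013, §5.B Prop. 5.16 (PDF p. 119)] -/
theorem CMInert.not_cmRamified (h : CMInert W p) : ¬ CMRamified W p := h.1

/-- An inert prime is not split (cases (ii)/(iii) of Cox's Prop. 5.16 are exclusive).
[cite: Cox2013, §5.B Prop. 5.16 (PDF p. 119)] -/
theorem CMInert.not_cmSplit (h : CMInert W p) : ¬ CMSplit W p := h.2

variable (W p) in
/-- `CMSplit` is "neither ramified nor inert" (pure logic on the definitions: `CMInert` is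
`¬ CMRamified ∧ ¬ CMSplit`, and `CMSplit` begins with `¬ p ∣ d = ¬ CMRamified`; Cox's trichotomy).
[cite: Cox2013, §5.B Prop. 5.16 (PDF p. 119)] -/
theorem cmSplit_iff_not_cmRamified_and_not_cmInert :
    CMSplit W p ↔ ¬ CMRamified W p ∧ ¬ CMInert W p := by
  unfold CMInert
  constructor
  · intro h
    exact ⟨h.1, fun hin => hin.2 h⟩
  · rintro ⟨hnr, hni⟩
    by_contra hns
    exact hni ⟨hnr, hns⟩

end Logic

/-! ### §2 The discriminant of the CM field -/

section CMField

variable {K : Type*} [Field K] [NumberField K]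
variable (W : WeierstrassCurve ℚ) [W.IsElliptic]

/-- **`d_K = cmFieldDiscrOfJ j`.** If `[K : ℚ] = 2` and `K` contains a square root of
`d = cmFieldDiscrOfJ j` for a CM `j`-invariant `j`, then `NumberField.discr K = d` (the nine fields
have discriminant equal to the table value; `Quadratic.discr_eq_of_sq_eq_intCast`).
[cite: SilvermanATAEC1994, App. A §3 (table of CM j-invariants, column "disc K")] -/
theorem discr_eq_cmFieldDiscrOfJ (h2 : finrank ℚ K = 2) {j : ℚ} (hj : j ∈ cmJInvariants) {θ : K}
    (hθ : θ ^ 2 = (cmFieldDiscrOfJ j : K)) : NumberField.discr K = cmFieldDiscrOfJ j :=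
  Quadratic.discr_eq_of_sq_eq_intCast h2 hθ (cmFieldDiscrOfJ_mem_of_mem_cmJInvariants hj)

/-- In the consumers' frame: `IsCMFieldOfJ K j` with `j ∈ maximalCMJInvariants` provides a square root
of `cmFieldDiscrOfJ j` in `K`. [cite: SilvermanATAEC1994, App. A §3 (table of CM j-invariants, column "disc K")] -/
theorem _root_.Literature.NumberTheory.EllipticCurves.IsCMFieldOfJ.exists_sq_eq_cmFieldDiscrOfJ
    {j : ℚ} (hj : j ∈ maximalCMJInvariants) (hK : IsCMFieldOfJ K j) :
    ∃ θ : K, θ ^ 2 = (cmFieldDiscrOfJ j : K) := by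
  obtain ⟨θ, hθ⟩ := hK.2
  exact ⟨θ, by rw [cmFieldDiscrOfJ_eq_cmFieldDiscr hj]; exact hθ⟩

/-- In the consumers' frame: `NumberField.discr K = cmFieldDiscrOfJ j` for `IsCMFieldOfJ K j`,
`j ∈ maximalCMJInvariants` (companion of `IsCMFieldOfJ.discr_eq`, which reads the other table
`cmFieldDiscr`). [cite: SilvermanATAEC1994, App. A §3 (table of CM j-invariants, column "disc K")] -/
theorem _root_.Literature.NumberTheory.EllipticCurves.IsCMFieldOfJ.discr_eq_cmFieldDiscrOfJ
    {j : ℚ} (hj : j ∈ maximalCMJInvariants) (hK : IsCMFieldOfJ K j) :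
    NumberField.discr K = cmFieldDiscrOfJ j := by
  rw [cmFieldDiscrOfJ_eq_cmFieldDiscr hj]
  exact hK.discr_eq hj

/-! ### §3 The three decomposition laws, general frame `[K : ℚ] = 2`, `θ² = cmFieldDiscrOfJ W.j` -/

/-- The ideal `p𝒪_K` of a rational prime is non-zero (plumbing). [folklore] -/
private theorem span_natCast_ringOfIntegers_ne_bot {p : ℕ} (hp : p.Prime) :
    Ideal.span {(p : 𝓞 K)} ≠ ⊥ := by
  rw [Ne, Ideal.span_singleton_eq_bot]
  exact_mod_cast hp.ne_zero

/-- **Cor. 5.17 (i): `CMRamified W p ↔ p ∣ d_K`.** For a CM curve `W/ℚ` (`W.j ∈ cmJInvariants`) and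
`K` quadratic containing `√(cmFieldDiscrOfJ W.j)`, the arithmetic predicate `CMRamified W p`
(`p ∣ cmFieldDiscrOfJ W.j`) is `p ∣ NumberField.discr K`.
[cite: Cox2013, §5.B Cor. 5.17 (i) (PDF p. 120)] -/
theorem cmRamified_iff_natCast_dvd_discr (h2 : finrank ℚ K = 2) (hj : W.j ∈ cmJInvariants) {θ : K}
    (hθ : θ ^ 2 = (cmFieldDiscrOfJ W.j : K)) (p : ℕ) :
    CMRamified W p ↔ (p : ℤ) ∣ NumberField.discr K := by
  unfold CMRamified
  rw [discr_eq_cmFieldDiscrOfJ h2 hj hθ]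

/-- **Cor. 5.17 (i), ideal-theoretically: `CMRamified W p ↔ p` is ramified in `𝒪_K`**
(`¬ Algebra.IsUnramifiedIn (𝓞 K) (p)`, Dedekind's discriminant theorem via the tree's
`RingClass.natCast_dvd_discr_iff_not_isUnramifiedIn`). [cite: Cox2013, §5.B Cor. 5.17 (i) (PDF p. 120)] -/
theorem cmRamified_iff_not_isUnramifiedIn (h2 : finrank ℚ K = 2) (hj : W.j ∈ cmJInvariants) {θ : K}
    (hθ : θ ^ 2 = (cmFieldDiscrOfJ W.j : K)) {p : ℕ} (hp : p.Prime) :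
    CMRamified W p ↔ ¬ Algebra.IsUnramifiedIn (𝓞 K) (Ideal.span {(p : ℤ)}) := by
  rw [cmRamified_iff_natCast_dvd_discr W h2 hj hθ p,
    Literature.NumberTheory.QuadraticFields.RingClass.natCast_dvd_discr_iff_not_isUnramifiedIn hp]

/-- For an odd prime `p` and an integer `d`: the Legendre symbol `(d/p) = 1` iff `p ∤ d` and `d` is a
square mod `p` (Mathlib `legendreSym.eq_one_iff` / `eq_zero_iff`; plumbing). [folklore] -/
private theorem legendreSym_eq_one_iff_not_dvd_and_isSquare {p : ℕ} [Fact p.Prime] (d : ℤ) :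
    legendreSym p d = 1 ↔ ¬ (p : ℤ) ∣ d ∧ IsSquare ((d : ℤ) : ZMod p) := by
  constructor
  · intro h1
    have h0 : ((d : ℤ) : ZMod p) ≠ 0 := by
      intro h0
      rw [(legendreSym.eq_zero_iff p d).mpr h0] at h1
      exact zero_ne_one h1
    refine ⟨?_, (legendreSym.eq_one_iff p h0).mp h1⟩
    rwa [Ne, ZMod.intCast_zmod_eq_zero_iff_dvd] at h0
  · rintro ⟨hnd, hsq⟩
    have h0 : ((d : ℤ) : ZMod p) ≠ 0 := by
      rwa [Ne, ZMod.intCast_zmod_eq_zero_iff_dvd]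
    exact (legendreSym.eq_one_iff p h0).mpr hsq

/-- For an odd prime `p` and an integer `d`: the Legendre symbol `(d/p) = -1` iff `p ∤ d` and `d` is
NOT a square mod `p` (the first clause is implied by the second: `0` is a square).
(Mathlib `legendreSym.eq_neg_one_iff`; plumbing.) [folklore] -/
private theorem legendreSym_eq_neg_one_iff_not_dvd_and_not_isSquare {p : ℕ} [Fact p.Prime] (d : ℤ) :
    legendreSym p d = -1 ↔ ¬ (p : ℤ) ∣ d ∧ ¬ IsSquare ((d : ℤ) : ZMod p) := by
  rw [legendreSym.eq_neg_one_iff]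
  constructor
  · intro hns
    refine ⟨fun hdvd => hns ?_, hns⟩
    rw [(ZMod.intCast_zmod_eq_zero_iff_dvd d p).mpr hdvd]
    exact IsSquare.zero
  · exact fun h => h.2

/-- **Cor. 5.17 (ii): `CMSplit W p ↔ p` splits in `K`** — exactly two primes of `𝒪_K` above `p`,
`((Ideal.span {(p : ℤ)}).primesOver (𝓞 K)).ncard = 2` (the tree's spelling of "split", as in the
Heegner hypothesis).  Every prime `p`: at odd `p` the clause `IsSquare (d : ZMod p) ∧ p ∤ d` is
`(d_K/p) = 1` (`Quadratic.ncard_primesOver_eq_two_iff_legendreSym`); at `p = 2` the clause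
`d ≡ 1 (mod 8)` is Cox's `(d_K/2) = 1` (`Quadratic.ncard_primesOver_two_eq_two_iff`).
[cite: Cox2013, §5.B Cor. 5.17 (ii) (PDF p. 120)] -/
theorem cmSplit_iff_ncard_primesOver_eq_two (h2 : finrank ℚ K = 2) (hj : W.j ∈ cmJInvariants)
    {θ : K} (hθ : θ ^ 2 = (cmFieldDiscrOfJ W.j : K)) {p : ℕ} (hp : p.Prime) :
    CMSplit W p ↔ ((Ideal.span {(p : ℤ)}).primesOver (𝓞 K)).ncard = 2 := by
  have hD := discr_eq_cmFieldDiscrOfJ h2 hj hθ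
  by_cases hp2 : p = 2
  · subst hp2
    have h := Literature.NumberTheory.QuadraticFields.Quadratic.ncard_primesOver_two_eq_two_iff
      (K := K) h2
    rw [hD] at h
    rw [Nat.cast_ofNat, h]
    unfold CMSplit
    rw [if_pos rfl, Nat.cast_ofNat]
    constructor
    · exact fun h' => h'.2
    · intro h'
      refine ⟨?_, h'⟩
      omega
  · haveI := Fact.mk hp
    rw [Literature.NumberTheory.QuadraticFields.Quadratic.ncard_primesOver_eq_two_iff_legendreSym h2 hp2,
      hD, legendreSym_eq_one_iff_not_dvd_and_isSquare]
    unfold CMSplit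
    rw [if_neg hp2]

/-- **Prop. 5.16 (iii) and its converse: `CMInert W p ↔ p𝒪_K` is a prime ideal**
(`(Ideal.span {(p : 𝓞 K)}).IsPrime`, the spelling of "inert" of `AgboolaHoward2005/…`, `LiXu2026/…`,
`HeegnerPointsHeckeOrbit.lean`).  Every prime `p`: at odd `p`, `CMInert` is `p ∤ d ∧ d` a non-square
mod `p`, i.e. `(d_K/p) = -1` (`RingClass.isPrime_span_natCast_iff_jacobiSym_eq_neg_one`); at `p = 2`
it is `d` odd and `d ≢ 1 (mod 8)`, i.e. `d ≡ 5 (mod 8)` since `d_K ≡ 0, 1 (mod 4)`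
(`RingClass.isPrime_span_two_iff`). [cite: Cox2013, §5.B Prop. 5.16 (iii) (PDF p. 119)] -/
theorem cmInert_iff_isPrime_span (h2 : finrank ℚ K = 2) (hj : W.j ∈ cmJInvariants) {θ : K}
    (hθ : θ ^ 2 = (cmFieldDiscrOfJ W.j : K)) {p : ℕ} (hp : p.Prime) :
    CMInert W p ↔ (Ideal.span {(p : 𝓞 K)}).IsPrime := by
  have hD := discr_eq_cmFieldDiscrOfJ h2 hj hθ
  by_cases hp2 : p = 2
  · subst hp2
    rw [Literature.NumberTheory.QuadraticFields.RingClass.isPrime_span_two_iff h2, hD]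
    have h4 : cmFieldDiscrOfJ W.j % 4 = 0 ∨ cmFieldDiscrOfJ W.j % 4 = 1 := by
      rw [← hD]
      exact Literature.NumberTheory.QuadraticFields.Quadratic.discr_emod_four h2
    unfold CMInert CMSplit CMRamified
    rw [if_pos rfl, Nat.cast_ofNat]
    constructor
    · rintro ⟨hnd, hns⟩
      have h1 : ¬ cmFieldDiscrOfJ W.j % 8 = 1 := fun h1 => hns ⟨hnd, h1⟩
      omega
    · intro h5
      refine ⟨?_, fun h => ?_⟩
      · omega
      · omega
  · haveI := Fact.mk hp
    rw [Literature.NumberTheory.QuadraticFields.RingClass.isPrime_span_natCast_iff_jacobiSym_eq_neg_one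
      h2 hp hp2, hD, ← jacobiSym.legendreSym.to_jacobiSym,
      legendreSym_eq_neg_one_iff_not_dvd_and_not_isSquare]
    unfold CMInert CMSplit CMRamified
    rw [if_neg hp2]
    constructor
    · rintro ⟨hnd, hns⟩
      exact ⟨hnd, fun hsq => hns ⟨hnd, hsq⟩⟩
    · rintro ⟨hnd, hnsq⟩
      exact ⟨hnd, fun h => hnsq h.2⟩

/-- **`CMSplit W p ↔ p ∤ d_K ∧ p𝒪_K` is not prime** — the spelling of "split" of `LiXu2026/…`
(`hnd : ¬ (p : ℤ) ∣ …`, `hns : ¬ (Ideal.span {(p : 𝓞 K)}).IsPrime`).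
[cite: Cox2013, §5.B Prop. 5.16 (PDF p. 119)] -/
theorem cmSplit_iff_not_dvd_discr_and_not_isPrime_span (h2 : finrank ℚ K = 2)
    (hj : W.j ∈ cmJInvariants) {θ : K} (hθ : θ ^ 2 = (cmFieldDiscrOfJ W.j : K)) {p : ℕ}
    (hp : p.Prime) :
    CMSplit W p ↔ ¬ (p : ℤ) ∣ NumberField.discr K ∧ ¬ (Ideal.span {(p : 𝓞 K)}).IsPrime := by
  rw [cmSplit_iff_not_cmRamified_and_not_cmInert, cmRamified_iff_natCast_dvd_discr W h2 hj hθ,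
    cmInert_iff_isPrime_span W h2 hj hθ hp]

/-- **The inert place.** If `CMInert W p` then `p𝒪_K` is a non-zero prime, i.e. a finite place
`w : HeightOneSpectrum (𝓞 K)` with `w.asIdeal = Ideal.span {(p : 𝓞 K)}` — the hypothesis shape of
`conductorExponent_baseChange_eq_of_inert` / `hasConductorExponentAt_iff_of_inert_of_gross`
(`ComplexMultiplicationDeuringConductor.lean`) and of `LiXu2026/…`.
[cite: Cox2013, §5.B Prop. 5.16 (iii) (PDF p. 119)] -/
theorem exists_asIdeal_eq_span_of_cmInert (h2 : finrank ℚ K = 2) (hj : W.j ∈ cmJInvariants)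
    {θ : K} (hθ : θ ^ 2 = (cmFieldDiscrOfJ W.j : K)) {p : ℕ} (hp : p.Prime) (hin : CMInert W p) :
    ∃ w : HeightOneSpectrum (𝓞 K), w.asIdeal = Ideal.span {(p : 𝓞 K)} :=
  ⟨⟨Ideal.span {(p : 𝓞 K)}, (cmInert_iff_isPrime_span W h2 hj hθ hp).mp hin,
    span_natCast_ringOfIntegers_ne_bot hp⟩, rfl⟩

/-- **Uniqueness of the inert place**: if `CMInert W p`, the only prime of `𝒪_K` containing `p` is
`p𝒪_K` itself (`p𝒪_K` is a non-zero prime, hence maximal, in the Dedekind domain `𝒪_K`).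
[cite: Cox2013, §5.B Prop. 5.16 (iii) and "Furthermore" (PDF p. 119)] -/
theorem asIdeal_eq_span_of_cmInert_of_mem (h2 : finrank ℚ K = 2) (hj : W.j ∈ cmJInvariants)
    {θ : K} (hθ : θ ^ 2 = (cmFieldDiscrOfJ W.j : K)) {p : ℕ} (hp : p.Prime) (hin : CMInert W p)
    (w : HeightOneSpectrum (𝓞 K)) (hw : (p : 𝓞 K) ∈ w.asIdeal) :
    w.asIdeal = Ideal.span {(p : 𝓞 K)} := by
  have hP : (Ideal.span {(p : 𝓞 K)}).IsPrime := (cmInert_iff_isPrime_span W h2 hj hθ hp).mp hin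
  have hmax : (Ideal.span {(p : 𝓞 K)}).IsMaximal :=
    hP.isMaximal (span_natCast_ringOfIntegers_ne_bot hp)
  exact (hmax.eq_of_le w.isPrime.ne_top ((Ideal.span_singleton_le_iff_mem _).mpr hw)).symm

/-- **At an inert `p` every finite place above `p` is `p𝒪_K`**: the `∀ v, v.asIdeal = p𝒪_K → …`
clauses of `LiXu2026/…` apply to every `v` with `↑p ∈ v.asIdeal`.
[cite: Cox2013, §5.B Prop. 5.16 (iii) (PDF p. 119)] -/
theorem primesOver_eq_singleton_of_cmInert (h2 : finrank ℚ K = 2) (hj : W.j ∈ cmJInvariants)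
    {θ : K} (hθ : θ ^ 2 = (cmFieldDiscrOfJ W.j : K)) {p : ℕ} (hp : p.Prime) (hin : CMInert W p) :
    (Ideal.span {(p : ℤ)}).primesOver (𝓞 K) = {Ideal.span {(p : 𝓞 K)}} := by
  have hP : (Ideal.span {(p : 𝓞 K)}).IsPrime := (cmInert_iff_isPrime_span W h2 hj hθ hp).mp hin
  have hmax : (Ideal.span {(p : 𝓞 K)}).IsMaximal :=
    hP.isMaximal (span_natCast_ringOfIntegers_ne_bot hp)
  ext Q
  simp only [Set.mem_singleton_iff]
  constructor
  · rintro ⟨hQ, hover⟩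
    have hpQ : (p : 𝓞 K) ∈ Q := by
      have h : (p : ℤ) ∈ Q.under ℤ := by
        rw [← hover.over]
        exact Ideal.mem_span_singleton_self _
      rw [Ideal.under_def, Ideal.mem_comap, map_natCast] at h
      exact h
    exact (hmax.eq_of_le hQ.ne_top ((Ideal.span_singleton_le_iff_mem _).mpr hpQ)).symm
  · rintro rfl
    have hmaxZ : (Ideal.span {(p : ℤ)}).IsMaximal :=
      PrincipalIdealRing.isMaximal_of_irreducible (Nat.prime_iff_prime_int.mp hp).irreducible
    refine ⟨hP, ⟨hmaxZ.eq_of_le ?_ ?_⟩⟩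
    · rw [Ideal.under_def]
      exact Ideal.comap_ne_top _ hP.ne_top
    · rw [Ideal.under_def, Ideal.span_le]
      intro x hx
      rw [Set.mem_singleton_iff.mp hx, SetLike.mem_coe, Ideal.mem_comap, map_natCast]
      exact Ideal.mem_span_singleton_self _

/-! ### §4 The consumers' frame: `W.j ∈ maximalCMJInvariants`, `IsCMFieldOfJ K W.j`

The `K`-side CM facts of the tree (`AgboolaHoward2005/…`, `LiXu2026/…`,
`ComplexMultiplicationDeuringConductor.lean`, `Rubin1991/…`, `BurungaleKobayashiNakamuraOta2026/…`)
quantify `∀ (K : Type) [Field K] [NumberField K], IsCMFieldOfJ K W.j → …` under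
`W.j ∈ maximalCMJInvariants`.  The laws of §3 in that frame, as dot-notation on `IsCMFieldOfJ`. -/

variable {W}

/-- `CMRamified W p ↔ p ∣ d_K` in the frame `IsCMFieldOfJ K W.j`.
[cite: Cox2013, §5.B Cor. 5.17 (i) (PDF p. 120)] -/
theorem _root_.Literature.NumberTheory.EllipticCurves.IsCMFieldOfJ.cmRamified_iff_natCast_dvd_discr
    (hj : W.j ∈ maximalCMJInvariants) (hK : IsCMFieldOfJ K W.j) (p : ℕ) :
    CMRamified W p ↔ (p : ℤ) ∣ NumberField.discr K := by
  obtain ⟨θ, hθ⟩ := hK.exists_sq_eq_cmFieldDiscrOfJ hj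
  exact Rank1Residual.cmRamified_iff_natCast_dvd_discr W hK.1 (maximalCMJInvariants_subset_cmJInvariants hj) hθ p

/-- `CMRamified W p ↔ p ∣ cmFieldDiscr W.j` (the table of `ComplexMultiplicationBurungaleFlachDescent.lean`,
the spelling `hnd : ¬ (p : ℤ) ∣ cmFieldDiscr W.j` of `LiXu2026/…`), for `W.j ∈ maximalCMJInvariants`.
[cite: SilvermanATAEC1994, App. A §3 (table of CM j-invariants)] -/
theorem cmRamified_iff_natCast_dvd_cmFieldDiscr (hj : W.j ∈ maximalCMJInvariants) (p : ℕ) :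
    CMRamified W p ↔ (p : ℤ) ∣ cmFieldDiscr W.j := by
  unfold CMRamified
  rw [cmFieldDiscrOfJ_eq_cmFieldDiscr hj]

/-- `CMRamified W p ↔ p` ramified in `𝒪_K`, in the frame `IsCMFieldOfJ K W.j`.
[cite: Cox2013, §5.B Cor. 5.17 (i) (PDF p. 120)] -/
theorem _root_.Literature.NumberTheory.EllipticCurves.IsCMFieldOfJ.cmRamified_iff_not_isUnramifiedIn
    (hj : W.j ∈ maximalCMJInvariants) (hK : IsCMFieldOfJ K W.j) {p : ℕ} (hp : p.Prime) :
    CMRamified W p ↔ ¬ Algebra.IsUnramifiedIn (𝓞 K) (Ideal.span {(p : ℤ)}) := by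
  obtain ⟨θ, hθ⟩ := hK.exists_sq_eq_cmFieldDiscrOfJ hj
  exact Rank1Residual.cmRamified_iff_not_isUnramifiedIn W hK.1 (maximalCMJInvariants_subset_cmJInvariants hj) hθ hp

/-- `CMSplit W p ↔` two primes of `𝒪_K` above `p`, in the frame `IsCMFieldOfJ K W.j`.
[cite: Cox2013, §5.B Cor. 5.17 (ii) (PDF p. 120)] -/
theorem _root_.Literature.NumberTheory.EllipticCurves.IsCMFieldOfJ.cmSplit_iff_ncard_primesOver_eq_two
    (hj : W.j ∈ maximalCMJInvariants) (hK : IsCMFieldOfJ K W.j) {p : ℕ} (hp : p.Prime) :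
    CMSplit W p ↔ ((Ideal.span {(p : ℤ)}).primesOver (𝓞 K)).ncard = 2 := by
  obtain ⟨θ, hθ⟩ := hK.exists_sq_eq_cmFieldDiscrOfJ hj
  exact Rank1Residual.cmSplit_iff_ncard_primesOver_eq_two W hK.1 (maximalCMJInvariants_subset_cmJInvariants hj) hθ hp

/-- `CMInert W p ↔ (p𝒪_K).IsPrime`, in the frame `IsCMFieldOfJ K W.j` — the bridge from the route
predicate to the hypothesis `hinert : (Ideal.span {(p : 𝓞 K)}).IsPrime` of `AgboolaHoward2005/…` and
`LiXu2026/…`. [cite: Cox2013, §5.B Prop. 5.16 (iii) (PDF p. 119)] -/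
theorem _root_.Literature.NumberTheory.EllipticCurves.IsCMFieldOfJ.cmInert_iff_isPrime_span
    (hj : W.j ∈ maximalCMJInvariants) (hK : IsCMFieldOfJ K W.j) {p : ℕ} (hp : p.Prime) :
    CMInert W p ↔ (Ideal.span {(p : 𝓞 K)}).IsPrime := by
  obtain ⟨θ, hθ⟩ := hK.exists_sq_eq_cmFieldDiscrOfJ hj
  exact Rank1Residual.cmInert_iff_isPrime_span W hK.1 (maximalCMJInvariants_subset_cmJInvariants hj) hθ hp

/-- `CMSplit W p ↔ p ∤ cmFieldDiscr W.j ∧ ¬ (p𝒪_K).IsPrime` — LITERALLY the pair of hypotheses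
`(hnd : ¬ (p : ℤ) ∣ cmFieldDiscr W.j) (hns : ¬ (Ideal.span {(p : 𝓞 K)}).IsPrime)` of the split-case
theorems of `LiXu2026/AnticyclotomicMordellWeilRankGrowth.lean`, in the frame `IsCMFieldOfJ K W.j`.
[cite: Cox2013, §5.B Prop. 5.16 (PDF p. 119)] -/
theorem _root_.Literature.NumberTheory.EllipticCurves.IsCMFieldOfJ.cmSplit_iff_not_dvd_and_not_isPrime_span
    (hj : W.j ∈ maximalCMJInvariants) (hK : IsCMFieldOfJ K W.j) {p : ℕ} (hp : p.Prime) :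
    CMSplit W p ↔ ¬ (p : ℤ) ∣ cmFieldDiscr W.j ∧ ¬ (Ideal.span {(p : 𝓞 K)}).IsPrime := by
  rw [cmSplit_iff_not_cmRamified_and_not_cmInert, cmRamified_iff_natCast_dvd_cmFieldDiscr hj,
    hK.cmInert_iff_isPrime_span hj hp]

/-- The inert place `𝔭 = p𝒪_K` as a `HeightOneSpectrum`, in the frame `IsCMFieldOfJ K W.j` (feeds
`hasConductorExponentAt_iff_of_inert_of_gross` and the `∀ v, v.asIdeal = p𝒪_K → …` clauses of
`LiXu2026/…`). [cite: Cox2013, §5.B Prop. 5.16 (iii) (PDF p. 119)] -/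
theorem _root_.Literature.NumberTheory.EllipticCurves.IsCMFieldOfJ.exists_asIdeal_eq_span_of_cmInert
    (hj : W.j ∈ maximalCMJInvariants) (hK : IsCMFieldOfJ K W.j) {p : ℕ} (hp : p.Prime)
    (hin : CMInert W p) :
    ∃ w : HeightOneSpectrum (𝓞 K), w.asIdeal = Ideal.span {(p : 𝓞 K)} := by
  obtain ⟨θ, hθ⟩ := hK.exists_sq_eq_cmFieldDiscrOfJ hj
  exact Rank1Residual.exists_asIdeal_eq_span_of_cmInert W hK.1 (maximalCMJInvariants_subset_cmJInvariants hj) hθ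
    hp hin

/-- Uniqueness of the inert place in the frame `IsCMFieldOfJ K W.j`: every prime of `𝒪_K` containing
`p` is `p𝒪_K`. [cite: Cox2013, §5.B Prop. 5.16 (iii) and "Furthermore" (PDF p. 119)] -/
theorem _root_.Literature.NumberTheory.EllipticCurves.IsCMFieldOfJ.asIdeal_eq_span_of_cmInert_of_mem
    (hj : W.j ∈ maximalCMJInvariants) (hK : IsCMFieldOfJ K W.j) {p : ℕ} (hp : p.Prime)
    (hin : CMInert W p) (w : HeightOneSpectrum (𝓞 K)) (hw : (p : 𝓞 K) ∈ w.asIdeal) :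
    w.asIdeal = Ideal.span {(p : 𝓞 K)} := by
  obtain ⟨θ, hθ⟩ := hK.exists_sq_eq_cmFieldDiscrOfJ hj
  exact Rank1Residual.asIdeal_eq_span_of_cmInert_of_mem W hK.1 (maximalCMJInvariants_subset_cmJInvariants hj) hθ
    hp hin w hw

/-- At an inert `p` the set of primes of `𝒪_K` above `p` is `{p𝒪_K}`, in the frame
`IsCMFieldOfJ K W.j`. [cite: Cox2013, §5.B Prop. 5.16 (iii) (PDF p. 119)] -/
theorem _root_.Literature.NumberTheory.EllipticCurves.IsCMFieldOfJ.primesOver_eq_singleton_of_cmInert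
    (hj : W.j ∈ maximalCMJInvariants) (hK : IsCMFieldOfJ K W.j) {p : ℕ} (hp : p.Prime)
    (hin : CMInert W p) :
    (Ideal.span {(p : ℤ)}).primesOver (𝓞 K) = {Ideal.span {(p : 𝓞 K)}} := by
  obtain ⟨θ, hθ⟩ := hK.exists_sq_eq_cmFieldDiscrOfJ hj
  exact Rank1Residual.primesOver_eq_singleton_of_cmInert W hK.1 (maximalCMJInvariants_subset_cmJInvariants hj) hθ
    hp hin

end CMField

end Literature.NumberTheory.EllipticCurves.Rank1Residual
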